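import Summits.QuantumFields.BalabanUV.Beta.FP.GaugeMultiplierBiLaplace
import Summits.QuantumFields.BalabanUV.Beta.FP.TwoLevelDefectFormula

/-!
# `BalabanUV.Beta.FP.TwoLevelDefectClosedForm` — road «FP» for binder row D1, sub-row **MS-1-GAUGE residual: THE ENTRYWISE TWO-LEVEL GAUGE-SLICE DEFECT
# OF THE TYPED RESOLVENTS IN CLOSED FORM** (owner d1-p3 gen 13, `LEAVES-FP.md` l.563):
# `Γ_{N′}(b₀, b) − Γ_M(b₀, b) − PQ_{N′,M}(b₀, b) = Σ'_y [ C_y(b₀)·β_y(b) + β_y(b₀)·C_y(b) ]`, every `d`, every `N′ = M·L` — the symmetric defect of an5's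
# transverse two-level law carries, in EVERY term, the pure gauge `β_y = −dz θ_y` on EXACTLY ONE leg and the level-`M` covariance column of an explicit
# exact force (`C_y = δdδΓ_M` read at the corner of block `y`) on the other; UNCONDITIONAL

HONEST DEPENDENCY (page 1, mandatory): continuum YM on T⁴ ⇐ BetaPertH ∧ nine spine estimates (0/9 proved); BetaPertH ⇐ (D1) ∧ (D4) ∧ CAP+tail;
G-an2-4 gates asym, D1 and NE2/3/4.  HONEST FRAMING (cell contract, verbatim): «discharging `BetaPertH` makes Bałaban's UV stability UNCONDITIONAL —
a real constructive-QFT result; it is NOT the continuum limit and NOT the Clay problem.»  THIS MODULE is [folklore]-grade bookkeeping (Fubini on absolutely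
convergent lattice sums) over an5's `GcolSum_decomposition` in the general form of the owner's g12 `TwoLevelDefectFormula`, an5's `decomposition_of_EL`, and the
owner's g13 `GaugeMultiplierBiLaplace` (the force-leg block sums `β_y` are curl-free with `M`-block-constant gauge quantity).  No `def`, no `def … : Prop`, nothing
cited, 0 sorry; 0 estimates of Bałaban's constrained objects; 0∕4 row-D1 binders; NOT the perfect level (next: `dec (Lc^j)` + units + `j → ∞`), NOT N2a∕N2b,
NOT (STEP)∕SDF, NOT D1, NOT BetaPertH, NOT continuum, NOT Clay.  «not in print; our bookkeeping».
ABSOLUTE RULE (cell charter, verbatim): «No internally-minted statement may enter as a cited fact. Every hypothesis is either kernel-proved in this package or a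
verbatim quotation of a PUBLISHED theorem with page reference. The manuscript(s) under audit are NOT citable for their own disputed steps — they are the thing
under adjudication; programme-internal (2001/route/tribunal) claims are never citable.»

WHY (owner's located reading, gen 13, toy-certified first: jobs j132676 ∕ j132700, all residuals ≤ 1e-12).  an5 located the gauge-slice defect of the two-level
law (`K1aNeg` false entrywise, `K1aTrans` true) and identified the composite `KInv_M ∘ ι(KInvStep) ∘ KInv_M` with `−PQ` (`compA_eq_neg_PQ`); the owner's g12
modules showed the entrywise defect `E = Γ_{N′} − Γ_M − PQ` is exact in one leg once the other is contracted with co-closed data, and wrote an5's decomposition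
with the gauge term KEPT.  N2a∕N2b need `E` ITSELF, contracted with vertex legs that are NOT co-closed.  THIS FILE: with
`β_y(l, x′) := blockSum_M (Mcol_{N′} l x′) y` (`= −dz θ_y`, `GaugeMultiplierBiLaplace`) and `C_y(κ, x) := (codiff₁∘dz∘codiff₁)(Γ_M(·; κ, x))(M•y)`,
**`E(κ,x; l,y) = Σ'_{y₀} [C_{y₀}(κ,x) β_{y₀}(l,y) + β_{y₀}(κ,x) C_{y₀}(l,y)]`** — manifestly symmetric; inside a one-loop trace every defect word meets the
Ward (divergence) letter of exactly one vertex (through `β = −dzθ`) and the divergence of the `Γ_M`-dressed other vertex (through `C`).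
PROOF.  (A) `decomp_single`: g12's `GcolSum_decomposition_general` + `gaugeTerm_eq_tsum_blockSum` on ONE column: `Γ_{N′}(l,y; b₁) = Γ_M(l,y; b₁) +
Σ'_{y₀} C_{y₀}(l,y) β_{y₀}(b₁) + Σ'_{w′}Σ_{l″} (𝒬_M Γ_{N′}(·;b₁))(l″,w′)·wH_M l l″ (y − M•w′)`.  (B) `inner_eq`: the inner sum of `PQ` is `𝒬_M` (first leg) of
that third term; `𝒬_M` kills `Γ_M` (`Gam_Q`), flips legs by `Gam_symm`, and passes through `Σ'_{y₀}`:
`I(μ,z′) = (𝒬_M Γ_{N′}(·;(l,y)))(μ,z′) − Σ'_{y₀} C_{y₀}(l,y)·(𝒬_M β_{y₀})(μ,z′)`.  (C) the outer sum: the first part is (A) again (column `(l,y)` read at `(κ,x)`);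
the second is `Σ'_{y₀} C_{y₀}(l,y)·[ℋ_M 𝒬_M β_{y₀}](κ,x)` by Fubini, and `ℋ_M 𝒬_M β_{y₀} = β_{y₀}` (`beta_eq_tsum`: an5's `decomposition_of_EL` at `(M·1, M, 1)` —
`β_{y₀}` is a bounded summable curl-free field with `M`-block-constant gauge quantity).

CONTENT (every `d`; `N′ = M·L`, `M, L ≥ 1`).
* §1 `GcolSum_singleton`, `McolSum_singleton`, `summable_C`, `abs_beta_le`∕`abs_contourSum_beta_le`, **`decomp_single`**, **`beta_eq_tsum`** (`ℋ_M𝒬_Mβ_y = β_y`).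
* §2 **`inner_eq`**, **`twoLevelDefect_closedForm`**:
  `Gam_{N′} κ x l y − Gam_M κ x l y − PQ_{N′} M x y κ l = Σ'_{y₀} (C_{y₀}(κ,x)·β_{y₀}(l,y) + β_{y₀}(κ,x)·C_{y₀}(l,y))`.
* §3 **`twoLevelDefect_closedForm_K`** (`(M, N′) = (Lc^j, Lc^{j+1})`): the same for the `E` of `TwoLevelGaugeDefect` ∕ an5's K-vocabulary
  (`KInv_inl_inl`, `compA_eq_neg_PQ`).
Provenance: road «FP» OWNER, unit b2b-balaban-beta-d1-p3 gen 13 (prover-b2b-balaban-beta-d1-p3-g13-0), 2026-08-21; no existing file touched.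
-/

noncomputable section

namespace Summit.QuantumFields.BalabanUV.Beta.FP.TwoLevelDefectClosedForm

open Finset
open scoped BigOperators
open Literature.MathematicalPhysics.QuantumFieldTheory
open Literature.MathematicalPhysics.QuantumFieldTheory.Balaban1983to89
open Literature.MathematicalPhysics.QuantumFieldTheory.Balaban1983to89.Beta
open B12Sec2to5 (l1 l1_nonneg Decay510)
open AffineAveraging (Form0 Form1 Form2 unitVec dz curv curvAdj codiff₁ box toSite blockSum contourSum)
open AffineReproduction (contourSumAdj IsBlockConst curvAdj_zero)
open KernelSpecInstance (wH)
open KKTFluctuationKernel (Gam GamM Gam_Q GamM_M)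
open KKTFluctuationEnergy (lip0 lip1 summable_mul_of_bdd summable_mul_of_bdd' abs_dz_le abs_codiff₁_le summable_dz summable_codiff₁
  Gcol Mcol Φcol δcol Gcol_bdd_summable Mcol_bdd_summable Gam_symm GcolSum)
open ResolventComposition (δSum McolSum contourSum_finset_sum contourSum_const_mul contourSum_tsum summable_wH_sub_zsmul Hcol_bdd_summable)
open ResolventCompositionStepB (GQ PQ decomposition_of_EL abs_contourSum_le summable_uncurry_of_tsum_abs_le compA_eq_neg_PQ)
open OneStepResolventKernel (KInv KInv_inl_inl)
open OneStepKernelFamily (KInvStep)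
open InterLevelTransport (liftW)
open ExpKernelCalculus (comp)
open TwoLevelDefectFormula (GcolSum_decomposition_general gaugeTerm_eq_tsum_blockSum)
open GaugeMultiplierBiLaplace (curv_blockSumMcol isBlockConst_gaugeObs_blockSumMcol blockSumMcol_bdd_summable)

variable {d : ℕ} {N' M L : ℕ} [NeZero N'] [NeZero M] [NeZero L]

/-! ## §1 One column decomposed with its gauge term; the block-summed force leg reproduced by the level-`M` minimisers -/

section Single

omit [NeZero M] [NeZero L] in
/-- [folklore] A singleton combination with coefficient `1` is the column. -/
theorem GcolSum_singleton (b : Fin (d + 1) × AffineAveraging.Site (d + 1)) :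
    GcolSum (N := N') {b} (fun _ => (1 : ℝ)) = Gcol (N := N') b.1 b.2 := by
  funext κ x
  simp [KKTFluctuationEnergy.GcolSum]

omit [NeZero M] [NeZero L] in
/-- [folklore] Likewise for the gauge multipliers. -/
theorem McolSum_singleton (b : Fin (d + 1) × AffineAveraging.Site (d + 1)) :
    McolSum (N := N') {b} (fun _ => (1 : ℝ)) = Mcol (N := N') b.1 b.2 := by
  funext z
  simp [ResolventComposition.McolSum]

omit [NeZero N'] [NeZero L] in
/-- [folklore] `y₀ ↦ C_{y₀}(l, y) = (δdδ Γ_M(·; l, y))(M•y₀)` is summable (a subseries, along the injective map `y₀ ↦ M•y₀`, of the summable 0-form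
`δdδ Γ_M(·; l, y)`). -/
theorem summable_C (l : Fin (d + 1)) (y : AffineAveraging.Site (d + 1)) :
    Summable (fun y₀ : AffineAveraging.Site (d + 1) => codiff₁ (dz (codiff₁ (Gcol (N := M) l y))) ((M : ℤ) • y₀)) := by
  obtain ⟨C, _, _, hGs⟩ := Gcol_bdd_summable (N := M) (d := d)
  have hs : Summable (codiff₁ (dz (codiff₁ (Gcol (N := M) l y)))) :=
    summable_codiff₁ fun κ => summable_dz (summable_codiff₁ (hGs l y)) κ
  have hinj : Function.Injective (fun y₀ : AffineAveraging.Site (d + 1) => (M : ℤ) • y₀) := by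
    intro a b hab
    have hM : (M : ℤ) ≠ 0 := by exact_mod_cast NeZero.ne M
    exact smul_right_injective (AffineAveraging.Site (d + 1)) hM hab
  exact hs.comp_injective hinj

omit [NeZero M] [NeZero L] in
/-- [folklore] Uniform bound of `𝒬_M β_{y₀}`. -/
theorem exists_abs_contourSum_beta_le : ∃ B : ℝ, 0 ≤ B ∧ ∀ (y₀ : AffineAveraging.Site (d + 1)) (μ : Fin (d + 1)) (z' : AffineAveraging.Site (d + 1)),
    |contourSum M (fun κ x => blockSum M (Mcol (N := N') κ x) y₀) μ z'| ≤ B := by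
  obtain ⟨Cβ, hCβ, hβb, _⟩ := blockSumMcol_bdd_summable (N' := N') (d := d) M
  exact ⟨(box (d + 1) M).card * (M * Cβ), by positivity, fun y₀ μ z' => abs_contourSum_le (fun κ x => hβb y₀ κ x) μ z'⟩

/-- [our proof] **ONE COLUMN OF `Γ_{N′}` DECOMPOSED AT LEVEL `M` WITH ITS GAUGE TERM** (g12's `GcolSum_decomposition_general` + `gaugeTerm_eq_tsum_blockSum` on the
singleton combination): for every source bond `(μ′, p)` and evaluation bond `(l, y)`,
`Γ_{N′}(l,y; μ′,p) = Γ_M(l,y; μ′,p) + Σ'_{y₀} C_{y₀}(l,y)·β_{y₀}(μ′,p) + Σ'_{w′} Σ_{l″} (𝒬_M Γ_{N′}(·; μ′,p))(l″,w′)·wH_M l l″ (y − M•w′)`. -/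
theorem decomp_single (hN : N' = M * L) (μ' : Fin (d + 1)) (p : AffineAveraging.Site (d + 1)) (l : Fin (d + 1))
    (y : AffineAveraging.Site (d + 1)) :
    Gam (N := N') l y μ' p
      = Gam (N := M) l y μ' p
        + (∑' y₀ : AffineAveraging.Site (d + 1), codiff₁ (dz (codiff₁ (Gcol (N := M) l y))) ((M : ℤ) • y₀)
            * blockSum M (Mcol (N := N') μ' p) y₀)
        + ∑' w' : AffineAveraging.Site (d + 1), ∑ l'' : Fin (d + 1),
            contourSum M (Gcol (N := N') μ' p) l'' w' * wH (N := M) (d := d) l l'' (y - (M : ℤ) • w') := by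
  have h := GcolSum_decomposition_general (d := d) hN {(μ', p)} (fun _ => (1 : ℝ)) l y
  rw [gaugeTerm_eq_tsum_blockSum, GcolSum_singleton, GcolSum_singleton, McolSum_singleton] at h
  exact h

/-- [our proof] **THE BLOCK-SUMMED FORCE LEG IS REPRODUCED BY THE LEVEL-`M` MINIMISERS**: `β_{y₀}(κ, x) = Σ'_{w′} Σ_{l″} (𝒬_M β_{y₀})(l″, w′)·wH_M κ l″ (x − M•w′)`
(an5's `decomposition_of_EL` at `(N′, M, L) := (M·1, M, 1)` with no force and no constraint multiplier: `β_{y₀}` is bounded, summable, curl-free and has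
`M`-block-constant gauge quantity — `GaugeMultiplierBiLaplace`). -/
theorem beta_eq_tsum (hN : N' = M * L) (y₀ : AffineAveraging.Site (d + 1)) (κ : Fin (d + 1)) (x : AffineAveraging.Site (d + 1)) :
    blockSum M (Mcol (N := N') κ x) y₀
      = ∑' w' : AffineAveraging.Site (d + 1), ∑ l'' : Fin (d + 1),
          contourSum M (fun κ' x' => blockSum M (Mcol (N := N') κ' x') y₀) l'' w' * wH (N := M) (d := d) κ l'' (x - (M : ℤ) • w') := by
  obtain ⟨Cβ, hCβ, hβb, hβs⟩ := blockSumMcol_bdd_summable (N' := N') (d := d) M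
  haveI : NeZero (M * 1) := ⟨by rw [Nat.mul_one]; exact NeZero.ne M⟩
  have hEL : curvAdj (curv (fun κ' x' => blockSum M (Mcol (N := N') κ' x') y₀))
      = contourSumAdj (M * 1) (0 : Form1 (d + 1) ℝ) + 0 := by
    rw [curv_blockSumMcol (N' := N') M y₀, curvAdj_zero]
    funext κ' x'
    simp [AffineReproduction.contourSumAdj]
  have hG : IsBlockConst (M * 1) (codiff₁ (dz (codiff₁ (fun κ' x' => blockSum M (Mcol (N := N') κ' x') y₀)))) := by
    rw [Nat.mul_one]
    exact isBlockConst_gaugeObs_blockSumMcol (N' := N') M hN y₀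
  have h := decomposition_of_EL (d := d) (N' := M * 1) (M := M) (L := 1) rfl (K := Cβ)
    (U := fun κ' x' => blockSum M (Mcol (N := N') κ' x') y₀) (a := 0) (Φ := 0)
    (fun μ x' => hβb y₀ μ x') (fun μ => hβs y₀ μ) (fun κ' y' => by simpa using hCβ) (fun μ x' => by simpa using hCβ) hEL hG κ x
  have h0 : lip1 (Gcol (N := M) κ x) (0 : Form1 (d + 1) ℝ) = 0 := by simp [KKTFluctuationEnergy.lip1]
  rw [h0, zero_add] at h
  exact h

end Single


/-! ## §2 The inner sum of `PQ`, and THE CLOSED FORM -/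

section ClosedForm

/-- [our proof] **THE INNER SUM OF `PQ`**: for the evaluation bond `(l, y)`,
`Σ'_{w′} Σ_ν GQ_{N′,M}(μ,z′; ν,w′)·wH_M l ν (y − M•w′) = (𝒬_M Γ_{N′}(·; l, y))(μ, z′) − Σ'_{y₀} C_{y₀}(l,y)·(𝒬_M β_{y₀})(μ, z′)`
(`GQ = 𝒬_M ⊗ 𝒬_M Γ_{N′}`; the first `𝒬_M` is taken outside, the decomposition `decomp_single` of each column is inserted, `𝒬_M Γ_M = 0` by `Gam_Q`, the legs are
flipped by `Gam_symm`, and `𝒬_M` passes through `Σ'_{y₀}`). -/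
theorem inner_eq (hN : N' = M * L) (l : Fin (d + 1)) (y : AffineAveraging.Site (d + 1)) (μ : Fin (d + 1)) (z' : AffineAveraging.Site (d + 1)) :
    (∑' w' : AffineAveraging.Site (d + 1), ∑ ν : Fin (d + 1), GQ (N := N') M μ z' ν w' * wH (N := M) (d := d) l ν (y - (M : ℤ) • w'))
      = contourSum M (Gcol (N := N') l y) μ z'
        - ∑' y₀ : AffineAveraging.Site (d + 1), codiff₁ (dz (codiff₁ (Gcol (N := M) l y))) ((M : ℤ) • y₀)
            * contourSum M (fun κ x => blockSum M (Mcol (N := N') κ x) y₀) μ z' := by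
  obtain ⟨CΓ, _, hGb, _⟩ := Gcol_bdd_summable (N := N') (d := d)
  obtain ⟨Cβ, hCβ, hβb, _⟩ := blockSumMcol_bdd_summable (N' := N') (d := d) M
  have hCs := summable_C (M := M) (d := d) l y
  -- (i) take the first `𝒬_M` outside the `w′`-sum
  have sT : ∀ (μ' : Fin (d + 1)) (p : AffineAveraging.Site (d + 1)),
      Summable fun w' : AffineAveraging.Site (d + 1) => ∑ ν, contourSum M (Gcol (N := N') μ' p) ν w' * wH (N := M) (d := d) l ν (y - (M : ℤ) • w') :=
    fun μ' p => summable_sum fun ν _ => summable_mul_of_bdd (fun w' => abs_contourSum_le (hGb μ' p) ν w') (summable_wH_sub_zsmul M l ν y)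
  have step1 : (∑' w', ∑ ν, GQ (N := N') M μ z' ν w' * wH (N := M) (d := d) l ν (y - (M : ℤ) • w'))
      = contourSum M (fun μ' p => ∑' w', ∑ ν, contourSum M (Gcol (N := N') μ' p) ν w' * wH (N := M) (d := d) l ν (y - (M : ℤ) • w')) μ z' := by
    rw [contourSum_tsum (fun w' μ' p => ∑ ν, contourSum M (Gcol (N := N') μ' p) ν w' * wH (N := M) (d := d) l ν (y - (M : ℤ) • w'))
      (fun μ' p => sT μ' p)]
    refine tsum_congr fun w' => ?_
    rw [contourSum_finset_sum (s := Finset.univ)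
      (A := fun ν μ' p => contourSum M (Gcol (N := N') μ' p) ν w' * wH (N := M) (d := d) l ν (y - (M : ℤ) • w'))]
    refine Finset.sum_congr rfl fun ν _ => ?_
    simp only [ResolventCompositionStepB.GQ, contourSum, Finset.sum_mul]
  -- (ii) the decomposition of each column, third term isolated
  have step2 : (fun μ' p => ∑' w', ∑ ν, contourSum M (Gcol (N := N') μ' p) ν w' * wH (N := M) (d := d) l ν (y - (M : ℤ) • w'))
      = fun μ' p => Gam (N := N') μ' p l y - Gam (N := M) μ' p l y
          - ∑' y₀, codiff₁ (dz (codiff₁ (Gcol (N := M) l y))) ((M : ℤ) • y₀) * blockSum M (Mcol (N := N') μ' p) y₀ := by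
    funext μ' p
    have h := decomp_single (d := d) hN μ' p l y
    rw [Gam_symm (N := N') μ' l p y, Gam_symm (N := M) μ' l p y]
    linarith
  rw [step1, step2]
  -- (iii) `𝒬_M` of the three pieces
  have q1 : contourSum M (fun μ' p => Gam (N := N') μ' p l y - Gam (N := M) μ' p l y
      - ∑' y₀, codiff₁ (dz (codiff₁ (Gcol (N := M) l y))) ((M : ℤ) • y₀) * blockSum M (Mcol (N := N') μ' p) y₀) μ z'
      = contourSum M (fun μ' p => Gam (N := N') μ' p l y) μ z' - contourSum M (fun μ' p => Gam (N := M) μ' p l y) μ z'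
        - contourSum M (fun μ' p => ∑' y₀, codiff₁ (dz (codiff₁ (Gcol (N := M) l y))) ((M : ℤ) • y₀) * blockSum M (Mcol (N := N') μ' p) y₀) μ z' := by
    simp only [contourSum, Finset.sum_sub_distrib]
  have q2 : contourSum M (fun μ' p => Gam (N := M) μ' p l y) μ z' = 0 := Gam_Q (N := M) l y μ z'
  have q3 : contourSum M (fun μ' p => ∑' y₀, codiff₁ (dz (codiff₁ (Gcol (N := M) l y))) ((M : ℤ) • y₀) * blockSum M (Mcol (N := N') μ' p) y₀) μ z'
      = ∑' y₀, codiff₁ (dz (codiff₁ (Gcol (N := M) l y))) ((M : ℤ) • y₀)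
          * contourSum M (fun κ x => blockSum M (Mcol (N := N') κ x) y₀) μ z' := by
    rw [contourSum_tsum (fun y₀ μ' p => codiff₁ (dz (codiff₁ (Gcol (N := M) l y))) ((M : ℤ) • y₀) * blockSum M (Mcol (N := N') μ' p) y₀)
      (fun μ' p => summable_mul_of_bdd' hCs (fun y₀ => hβb y₀ μ' p))]
    refine tsum_congr fun y₀ => ?_
    exact contourSum_const_mul _ (fun κ x => blockSum M (Mcol (N := N') κ x) y₀) μ z'
  rw [q1, q2, q3, sub_zero]
  rfl

/-- [our proof] **THE ENTRYWISE TWO-LEVEL GAUGE-SLICE DEFECT IN CLOSED FORM** (every `d`, `N′ = M·L`):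
`Γ_{N′}(κ,x; l,y) − Γ_M(κ,x; l,y) − PQ_{N′,M}(x,y; κ,l) = Σ'_{y₀} [ C_{y₀}(κ,x)·β_{y₀}(l,y) + β_{y₀}(κ,x)·C_{y₀}(l,y) ]`, where
`β_{y₀}(l,x′) = blockSum_M (Mcol_{N′} l x′) y₀` is the `M`-block sum of the gauge multiplier in its force leg (`= −dz θ_{y₀}`, `GaugeMultiplierBiLaplace`) and
`C_{y₀}(κ,x) = (codiff₁∘dz∘codiff₁)(Γ_M(·; κ,x))(M•y₀)` is the gauge quantity of the level-`M` covariance column at the corner of block `y₀` (the covariance field of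
the explicit exact force `dz δd δ⁰_{M•y₀}` read at `(κ,x)`, by `Gam_symm`).  `PQ = ℋ_M (𝒬_M⊗𝒬_M Γ_{N′}) ℋ_Mᵀ` is an5's composite (`compA_eq_neg_PQ`). -/
theorem twoLevelDefect_closedForm (hN : N' = M * L) (κ : Fin (d + 1)) (x : AffineAveraging.Site (d + 1)) (l : Fin (d + 1))
    (y : AffineAveraging.Site (d + 1)) :
    Gam (N := N') κ x l y - Gam (N := M) κ x l y - PQ (N := N') M x y κ l
      = ∑' y₀ : AffineAveraging.Site (d + 1),
          (codiff₁ (dz (codiff₁ (Gcol (N := M) κ x))) ((M : ℤ) • y₀) * blockSum M (Mcol (N := N') l y) y₀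
            + blockSum M (Mcol (N := N') κ x) y₀ * codiff₁ (dz (codiff₁ (Gcol (N := M) l y))) ((M : ℤ) • y₀)) := by
  obtain ⟨CΓ, _, hGb, _⟩ := Gcol_bdd_summable (N := N') (d := d)
  obtain ⟨Cβ, hCβ, hβb, _⟩ := blockSumMcol_bdd_summable (N' := N') (d := d) M
  obtain ⟨B, hB, hQβ⟩ := exists_abs_contourSum_beta_le (N' := N') (M := M) (d := d)
  have hCs := summable_C (M := M) (d := d) l y
  have hCs' := summable_C (M := M) (d := d) κ x
  -- abbreviations
  set Cly : AffineAveraging.Site (d + 1) → ℝ := fun y₀ => codiff₁ (dz (codiff₁ (Gcol (N := M) l y))) ((M : ℤ) • y₀) with hCly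
  set g : AffineAveraging.Site (d + 1) → AffineAveraging.Site (d + 1) → ℝ := fun y₀ z' =>
    ∑ μ, contourSum M (fun κ' x' => blockSum M (Mcol (N := N') κ' x') y₀) μ z' * wH (N := M) (d := d) κ μ (x - (M : ℤ) • z') with hg
  -- summability bookkeeping
  have sW : ∀ μ, Summable fun z' : AffineAveraging.Site (d + 1) => |wH (N := M) (d := d) κ μ (x - (M : ℤ) • z')| :=
    fun μ => (summable_wH_sub_zsmul M κ μ x).abs
  have sg : ∀ y₀, Summable (g y₀) := fun y₀ =>
    summable_sum fun μ _ => summable_mul_of_bdd (fun z' => hQβ y₀ μ z') (summable_wH_sub_zsmul M κ μ x)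
  have g_abs : ∀ y₀ z', |g y₀ z'| ≤ B * ∑ μ, |wH (N := M) (d := d) κ μ (x - (M : ℤ) • z')| := by
    intro y₀ z'
    rw [hg, Finset.mul_sum]
    refine (Finset.abs_sum_le_sum_abs _ _).trans (Finset.sum_le_sum fun μ _ => ?_)
    rw [abs_mul]
    exact mul_le_mul_of_nonneg_right (hQβ y₀ μ z') (abs_nonneg _)
  set G₁ : ℝ := ∑' z', B * ∑ μ, |wH (N := M) (d := d) κ μ (x - (M : ℤ) • z')| with hG₁
  have sG : Summable fun z' : AffineAveraging.Site (d + 1) => B * ∑ μ, |wH (N := M) (d := d) κ μ (x - (M : ℤ) • z')| :=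
    (summable_sum fun μ _ => sW μ).mul_left B
  have g_l1 : ∀ y₀, ∑' z', |g y₀ z'| ≤ G₁ := fun y₀ => Summable.tsum_le_tsum (g_abs y₀) (sg y₀).abs sG
  have sU : Summable (Function.uncurry fun y₀ z' => Cly y₀ * g y₀ z') := by
    refine summable_uncurry_of_tsum_abs_le (B := fun y₀ => |Cly y₀| * G₁) (fun y₀ => (sg y₀).mul_left _) (fun y₀ => ?_) (hCs.abs.mul_right G₁)
    have h1 : ∑' z', |Cly y₀ * g y₀ z'| = |Cly y₀| * ∑' z', |g y₀ z'| := by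
      rw [← tsum_mul_left]; exact tsum_congr fun z' => abs_mul _ _
    rw [h1]
    exact mul_le_mul_of_nonneg_left (g_l1 y₀) (abs_nonneg _)
  -- (1) rewrite the inner sums of `PQ`
  have hPQ : PQ (N := N') M x y κ l
      = ∑' z', ∑ μ, wH (N := M) (d := d) κ μ (x - (M : ℤ) • z')
          * (contourSum M (Gcol (N := N') l y) μ z' - ∑' y₀, Cly y₀ * contourSum M (fun κ' x' => blockSum M (Mcol (N := N') κ' x') y₀) μ z') := by
    unfold ResolventCompositionStepB.PQ
    exact tsum_congr fun z' => Finset.sum_congr rfl fun μ _ => by rw [inner_eq (d := d) hN l y μ z']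
  -- (2) split into the transverse part and the gauge part
  have sA : Summable fun z' : AffineAveraging.Site (d + 1) => ∑ μ, wH (N := M) (d := d) κ μ (x - (M : ℤ) • z') * contourSum M (Gcol (N := N') l y) μ z' :=
    summable_sum fun μ _ => summable_mul_of_bdd' (summable_wH_sub_zsmul M κ μ x) (fun z' => abs_contourSum_le (hGb l y) μ z')
  have inner2 : ∀ z', ∑ μ, wH (N := M) (d := d) κ μ (x - (M : ℤ) • z')
      * (∑' y₀, Cly y₀ * contourSum M (fun κ' x' => blockSum M (Mcol (N := N') κ' x') y₀) μ z') = ∑' y₀, Cly y₀ * g y₀ z' := by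
    intro z'
    have hs : ∀ μ, Summable fun y₀ => Cly y₀ * contourSum M (fun κ' x' => blockSum M (Mcol (N := N') κ' x') y₀) μ z' :=
      fun μ => summable_mul_of_bdd' hCs (fun y₀ => hQβ y₀ μ z')
    have hs' : ∀ μ ∈ Finset.univ, Summable fun y₀ => wH (N := M) (d := d) κ μ (x - (M : ℤ) • z')
        * (Cly y₀ * contourSum M (fun κ' x' => blockSum M (Mcol (N := N') κ' x') y₀) μ z') := fun μ _ => (hs μ).mul_left _
    rw [Finset.sum_congr rfl fun μ _ => (tsum_mul_left).symm, ← Summable.tsum_finsetSum hs']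
    refine tsum_congr fun y₀ => ?_
    rw [hg, Finset.mul_sum]
    exact Finset.sum_congr rfl fun μ _ => by ring
  have sBz : Summable fun z' : AffineAveraging.Site (d + 1) => ∑' y₀, Cly y₀ * g y₀ z' := sU.prod_symm.prod
  have hsplit : PQ (N := N') M x y κ l
      = (∑' z', ∑ μ, wH (N := M) (d := d) κ μ (x - (M : ℤ) • z') * contourSum M (Gcol (N := N') l y) μ z')
        - ∑' z', ∑' y₀, Cly y₀ * g y₀ z' := by
    rw [hPQ]
    have e : ∀ z', ∑ μ, wH (N := M) (d := d) κ μ (x - (M : ℤ) • z')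
        * (contourSum M (Gcol (N := N') l y) μ z' - ∑' y₀, Cly y₀ * contourSum M (fun κ' x' => blockSum M (Mcol (N := N') κ' x') y₀) μ z')
        = (∑ μ, wH (N := M) (d := d) κ μ (x - (M : ℤ) • z') * contourSum M (Gcol (N := N') l y) μ z') - ∑' y₀, Cly y₀ * g y₀ z' := by
      intro z'
      rw [← inner2 z', ← Finset.sum_sub_distrib]
      exact Finset.sum_congr rfl fun μ _ => by ring
    rw [tsum_congr e, sA.tsum_sub sBz]
  -- (3) the transverse part is the column `(l, y)` decomposed at `(κ, x)`
  have hT : (∑' z', ∑ μ, wH (N := M) (d := d) κ μ (x - (M : ℤ) • z') * contourSum M (Gcol (N := N') l y) μ z')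
      = Gam (N := N') κ x l y - Gam (N := M) κ x l y - ∑' y₀, codiff₁ (dz (codiff₁ (Gcol (N := M) κ x))) ((M : ℤ) • y₀) * blockSum M (Mcol (N := N') l y) y₀ := by
    have h := decomp_single (d := d) hN l y κ x
    have e : (∑' z', ∑ μ, wH (N := M) (d := d) κ μ (x - (M : ℤ) • z') * contourSum M (Gcol (N := N') l y) μ z')
        = ∑' w', ∑ l'', contourSum M (Gcol (N := N') l y) l'' w' * wH (N := M) (d := d) κ l'' (x - (M : ℤ) • w') :=
      tsum_congr fun w' => Finset.sum_congr rfl fun l'' _ => mul_comm _ _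
    rw [e]
    linarith
  -- (4) the gauge part by Fubini and `ℋ_M 𝒬_M β = β`
  have hG : (∑' z', ∑' y₀, Cly y₀ * g y₀ z') = ∑' y₀, blockSum M (Mcol (N := N') κ x) y₀ * Cly y₀ := by
    rw [sU.tsum_comm]
    refine tsum_congr fun y₀ => ?_
    show (∑' z', Cly y₀ * g y₀ z') = _
    rw [tsum_mul_left, hg]
    simp only []
    rw [← beta_eq_tsum (d := d) hN y₀ κ x, mul_comm]
  -- assemble
  have sF1 : Summable fun y₀ => codiff₁ (dz (codiff₁ (Gcol (N := M) κ x))) ((M : ℤ) • y₀) * blockSum M (Mcol (N := N') l y) y₀ :=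
    summable_mul_of_bdd' hCs' (fun y₀ => hβb y₀ l y)
  have sF2 : Summable fun y₀ => blockSum M (Mcol (N := N') κ x) y₀ * codiff₁ (dz (codiff₁ (Gcol (N := M) l y))) ((M : ℤ) • y₀) :=
    summable_mul_of_bdd (fun y₀ => hβb y₀ κ x) hCs
  rw [hsplit, hT, hG]
  simp only [hCly]
  rw [sF1.tsum_add sF2]
  ring

end ClosedForm

/-! ## §3 The same in an5's K-vocabulary at `(M, N′) = (Lc^j, Lc^{j+1})` -/

section KForm

variable (Lc : ℕ) [NeZero Lc]

/-- [our proof] **THE DEFECT OF `TwoLevelGaugeDefect` ∕ `PerfectGaugeDefect` IN CLOSED FORM** (every `d`, `Lc ≥ 1`, `j`): with `M = Lc^j`, `N′ = Lc^{j+1}`,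
`[KInv_{N′} − KInv_M + KInv_M ∘ liftW M (KInvStep Lc j) ∘ KInv_M](x, y; inl κ, inl l) = Σ'_{y₀} [ C_{y₀}(κ,x)·β_{y₀}(l,y) + β_{y₀}(κ,x)·C_{y₀}(l,y) ]`
(`KInv_inl_inl`, `compA_eq_neg_PQ`, `twoLevelDefect_closedForm`). -/
theorem twoLevelDefect_closedForm_K (j : ℕ) (x y : AffineAveraging.Site (d + 1)) (κ l : Fin (d + 1)) :
    haveI : NeZero (Lc ^ j) := ⟨pow_ne_zero _ (NeZero.ne Lc)⟩
    haveI : NeZero (Lc ^ (j + 1)) := ⟨pow_ne_zero _ (NeZero.ne Lc)⟩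
    KInv (N := Lc ^ (j + 1)) (d := d) x y (Sum.inl κ) (Sum.inl l)
        - (KInv (N := Lc ^ j) (d := d) x y (Sum.inl κ) (Sum.inl l)
          - comp (KInv (N := Lc ^ j) (d := d))
              (comp (liftW (Lc ^ j) true true (KInvStep (d := d) Lc j)) (KInv (N := Lc ^ j) (d := d))) x y (Sum.inl κ) (Sum.inl l))
      = ∑' y₀ : AffineAveraging.Site (d + 1),
          (codiff₁ (dz (codiff₁ (Gcol (N := Lc ^ j) κ x))) (((Lc ^ j : ℕ) : ℤ) • y₀) * blockSum (Lc ^ j) (Mcol (N := Lc ^ (j + 1)) l y) y₀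
            + blockSum (Lc ^ j) (Mcol (N := Lc ^ (j + 1)) κ x) y₀ * codiff₁ (dz (codiff₁ (Gcol (N := Lc ^ j) l y))) (((Lc ^ j : ℕ) : ℤ) • y₀)) := by
  haveI : NeZero (Lc ^ j) := ⟨pow_ne_zero _ (NeZero.ne Lc)⟩
  haveI : NeZero (Lc ^ (j + 1)) := ⟨pow_ne_zero _ (NeZero.ne Lc)⟩
  rw [compA_eq_neg_PQ, KInv_inl_inl, KInv_inl_inl,
    ← twoLevelDefect_closedForm (N' := Lc ^ (j + 1)) (M := Lc ^ j) (L := Lc) (pow_succ Lc j) κ x l y]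
  ring

end KForm

end Summit.QuantumFields.BalabanUV.Beta.FP.TwoLevelDefectClosedForm

end
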